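import Summits.QuantumFields.BalabanUV.T4Continuum.Support.VariationalCovariantFederbush
import Summits.QuantumFields.BalabanUV.T4Continuum.Support.BalabanAveragedCoerciveFibre

/-!
# T⁴ programme, spine node NE2 (U1a), lane P2 — THE CORE OF LEAF REG⁺: a COVARIANT LATTICE H²-ESTIMATE for the charged scalar,
# `Σ_{ν,μ} ‖D_ν D_μ λ‖² ≤ 2‖Δ_R λ‖² + d²a_f²‖λ‖² + 2d·a_f·Σ_μ‖D_μ λ‖²` (all second covariant differences by the covariant Laplacian, up to
# plaquette-holonomy defects `a_f`), every torus, every field (`t4/skeletons/NE2-t4-ne2-p2.md` v0.7 §2.C leaf REG⁺; cell `pub-balaban`, row NE2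
# co-owner #2, lineage t4-ne2-p2 gen 10)

HONEST FRAMING (T4-DAG p. 1).  Rung (B)+1 only — NOT infinite volume, NOT a mass gap, NOT Clay.  NE2 is NOT IN PRINT and NOT proved here.  MODEL
LEVEL: U(1) bond phases `R` of unit modulus are DATA; `a_f` bounds the plaquette defects `|R(y,μ)R(y+e_μ,ν) − R(y,ν)R(y+e_ν,μ)|`; lattice units; scalar
sector; [folklore] operator algebra (the Bochner/Weitzenböck mechanism for exact 1-forms: `D_νᴴD_νD_μ = D_μD_νᴴD_ν + D_νᴴ[D_ν, D_μ] + [D_νᴴ, D_μ]D_ν`, the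
commutators being plaquette defects — cf. the tree's abstract identity `LatticeWeitzenbock.weitzenbock` (P1), here in the form the variational route consumes).
With the Euler–Lagrange equation of the constrained minimiser (`VariationalKKT.euler_lagrange`: `Δ_R(Hμ) ∝ Q_Tᴴ X μ`) this is leaf REG⁺ (the regularity
functional `ρ` of `VariationalCovariantAssembly.pair_bracket` at the minimiser is bounded by the effective action and the unit datum) — that link is the
sibling file `Support/VariationalCovariantRegularity`.  Nothing printed is a hypothesis ([Balaban1985BackgroundPropagators] (3.3)/(3.23) shapes); no
`def … : Prop` fact; no `sorry`; axioms standard.  HONEST DEPENDENCY (cell, verbatim): continuum YM on T⁴ ⇐ BetaPertH ∧ nine spine estimates (0/9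
proved); BetaPertH ⇐ (D1) ∧ (D4) ∧ CAP+tail; G-an2-4 gates asym, D1 and NE2/3/4.
-/

noncomputable section

open scoped BigOperators ComplexConjugate Matrix

namespace Summit.QuantumFields.BalabanUV.T4Continuum.VariationalCovariantH2

open Finset
open Literature.MathematicalPhysics.QuantumFieldTheory.Balaban1983to89
open Literature.MathematicalPhysics.QuantumFieldTheory.Balaban1983to89.B5Prop11Plancherel (Tor unitVec)
open Literature.MathematicalPhysics.QuantumFieldTheory.Balaban1983to89.B5Prop11Lower (nsq nsq_nonneg star_dotProduct_self norm_star_dotProduct_le)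
open Summit.QuantumFields.BalabanUV.T4Continuum.VariationalCovariantFederbush (cD dirU)
open Summit.QuantumFields.BalabanUV.T4Continuum.BalabanAveragedCoerciveFibre (star_dotProduct_conjTranspose_mulVec)

variable {d : ℕ} (N : Fin d → ℕ) [∀ μ, NeZero (N μ)]

/-! ## §1 The covariant shift and difference operators as matrices -/

/-- the covariant shift `(T_μ λ)(y) = R(y,μ)·λ(y + e_μ)`. [folklore] -/
def Tm (R : Tor N → Fin d → ℂ) (μ : Fin d) : Matrix (Tor N) (Tor N) ℂ :=
  Matrix.of fun y x => if x = y + unitVec N μ then R y μ else 0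

/-- the covariant difference `D_μ = T_μ − 1` ([B9] (3.3) shape). [folklore] -/
def Dm (R : Tor N → Fin d → ℂ) (μ : Fin d) : Matrix (Tor N) (Tor N) ℂ := Tm N R μ - 1

variable (R : Tor N → Fin d → ℂ)

/-- `(T_μ λ)(y) = R(y,μ)λ(y+e_μ)`. [folklore] -/
theorem Tm_mulVec (μ : Fin d) (f : Tor N → ℂ) (y : Tor N) : (Tm N R μ *ᵥ f) y = R y μ * f (y + unitVec N μ) := by
  simp only [Matrix.mulVec, dotProduct, Tm, Matrix.of_apply, ite_mul, zero_mul, Finset.sum_ite_eq', Finset.mem_univ, if_true]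

/-- `(T_μᴴ g)(y) = conj R(y − e_μ, μ)·g(y − e_μ)`. [folklore] -/
theorem Tm_conjTranspose_mulVec (μ : Fin d) (g : Tor N → ℂ) (y : Tor N) :
    ((Tm N R μ)ᴴ *ᵥ g) y = (starRingEnd ℂ) (R (y - unitVec N μ) μ) * g (y - unitVec N μ) := by
  simp only [Matrix.mulVec, dotProduct, Matrix.conjTranspose_apply, Tm, Matrix.of_apply]
  rw [Finset.sum_eq_single (y - unitVec N μ)]
  · rw [if_pos (by abel), Complex.star_def]
  · intro x _ hx
    rw [if_neg, star_zero, zero_mul]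
    intro h; apply hx; rw [h]; abel
  · intro h; exact absurd (Finset.mem_univ _) h

/-- `(D_μ λ)(y) = R(y,μ)λ(y+e_μ) − λ(y)` = `cD`. [folklore] -/
theorem Dm_mulVec (μ : Fin d) (f : Tor N → ℂ) (y : Tor N) : (Dm N R μ *ᵥ f) y = cD N R f y μ := by
  rw [Dm, Matrix.sub_mulVec, Matrix.one_mulVec, Pi.sub_apply, Tm_mulVec, cD]

/-- `Σ_y |(D_μ λ)(y)|² = dirU`. [folklore] -/
theorem nsq_Dm_mulVec (μ : Fin d) (f : Tor N → ℂ) : nsq (Dm N R μ *ᵥ f) = dirU N R f μ := by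
  unfold nsq dirU
  exact Finset.sum_congr rfl fun y _ => by rw [Dm_mulVec]

/-! ## §2 The two commutators are plaquette-holonomy defects -/

/-- the plaquette defect `P(y;μ,ν) = R(y,μ)R(y+e_μ,ν) − R(y,ν)R(y+e_ν,μ)`. [folklore] -/
def plaq (y : Tor N) (μ ν : Fin d) : ℂ := R y μ * R (y + unitVec N μ) ν - R y ν * R (y + unitVec N ν) μ

/-- `([T_μ, T_ν] λ)(y) = P(y;μ,ν)·λ(y + e_μ + e_ν)`. [folklore] -/
theorem comm_Tm_mulVec (μ ν : Fin d) (f : Tor N → ℂ) (y : Tor N) :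
    ((Tm N R μ * Tm N R ν - Tm N R ν * Tm N R μ) *ᵥ f) y = plaq N R y μ ν * f (y + unitVec N μ + unitVec N ν) := by
  rw [Matrix.sub_mulVec, Pi.sub_apply, ← Matrix.mulVec_mulVec, ← Matrix.mulVec_mulVec, Tm_mulVec, Tm_mulVec, Tm_mulVec, Tm_mulVec, plaq]
  have e : y + unitVec N ν + unitVec N μ = y + unitVec N μ + unitVec N ν := by abel
  rw [e]; ring

/-- `([T_νᴴ, T_μ] λ)(y) = b(y)·λ(y − e_ν + e_μ)` with `b(y) = conj R(y−e_ν,ν)R(y−e_ν,μ) − R(y,μ)conj R(y+e_μ−e_ν,ν)`. [folklore] -/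
theorem comm_TmH_Tm_mulVec (μ ν : Fin d) (f : Tor N → ℂ) (y : Tor N) :
    (((Tm N R ν)ᴴ * Tm N R μ - Tm N R μ * (Tm N R ν)ᴴ) *ᵥ f) y
      = ((starRingEnd ℂ) (R (y - unitVec N ν) ν) * R (y - unitVec N ν) μ
          - R y μ * (starRingEnd ℂ) (R (y + unitVec N μ - unitVec N ν) ν)) * f (y - unitVec N ν + unitVec N μ) := by
  rw [Matrix.sub_mulVec, Pi.sub_apply, ← Matrix.mulVec_mulVec, ← Matrix.mulVec_mulVec, Tm_conjTranspose_mulVec, Tm_mulVec,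
    Tm_mulVec, Tm_conjTranspose_mulVec]
  have e : y + unitVec N μ - unitVec N ν = y - unitVec N ν + unitVec N μ := by abel
  rw [e]; ring

omit [∀ μ, NeZero (N μ)] in
/-- for unit-modulus phases the mixed commutator coefficient has the modulus of a plaquette defect:
`|b(y)| = |P(y − e_ν; μ, ν)|`. [folklore] -/
theorem norm_mixed_coeff (hR : ∀ y μ, ‖R y μ‖ = 1) (μ ν : Fin d) (y : Tor N) :
    ‖(starRingEnd ℂ) (R (y - unitVec N ν) ν) * R (y - unitVec N ν) μ - R y μ * (starRingEnd ℂ) (R (y + unitVec N μ - unitVec N ν) ν)‖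
      = ‖plaq N R (y - unitVec N ν) μ ν‖ := by
  set w := y - unitVec N ν with hw
  have e1 : y = w + unitVec N ν := by rw [hw]; abel
  have e2 : y + unitVec N μ - unitVec N ν = w + unitVec N μ := by rw [hw]; abel
  rw [e2, e1]
  -- multiply by the unit `R(w,ν)·R(w+e_μ,ν)`
  have hu : ‖R w ν * R (w + unitVec N μ) ν‖ = 1 := by rw [norm_mul, hR, hR, one_mul]
  have key : ((starRingEnd ℂ) (R w ν) * R w μ - R (w + unitVec N ν) μ * (starRingEnd ℂ) (R (w + unitVec N μ) ν))
      * (R w ν * R (w + unitVec N μ) ν) = plaq N R w μ ν := by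
    have h1 : (starRingEnd ℂ) (R w ν) * R w ν = 1 := by
      rw [mul_comm, Complex.mul_conj, Complex.normSq_eq_norm_sq, hR, one_pow, Complex.ofReal_one]
    have h2 : (starRingEnd ℂ) (R (w + unitVec N μ) ν) * R (w + unitVec N μ) ν = 1 := by
      rw [mul_comm, Complex.mul_conj, Complex.normSq_eq_norm_sq, hR, one_pow, Complex.ofReal_one]
    unfold plaq
    calc ((starRingEnd ℂ) (R w ν) * R w μ - R (w + unitVec N ν) μ * (starRingEnd ℂ) (R (w + unitVec N μ) ν)) * (R w ν * R (w + unitVec N μ) ν)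
        = R w μ * R (w + unitVec N μ) ν * ((starRingEnd ℂ) (R w ν) * R w ν)
          - R w ν * R (w + unitVec N ν) μ * ((starRingEnd ℂ) (R (w + unitVec N μ) ν) * R (w + unitVec N μ) ν) := by ring
      _ = _ := by rw [h1, h2, mul_one, mul_one]
  have := congrArg (fun z : ℂ => ‖z‖) key
  simp only [norm_mul, hu, mul_one] at this
  rw [← this]

/-- `Σ|[T_μ,T_ν]λ|² ≤ a_f²·Σ|λ|²`. [folklore] -/
theorem nsq_comm_le {af : ℝ} (haf : ∀ y μ ν, ‖plaq N R y μ ν‖ ≤ af) (μ ν : Fin d) (f : Tor N → ℂ) :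
    nsq ((Tm N R μ * Tm N R ν - Tm N R ν * Tm N R μ) *ᵥ f) ≤ af ^ 2 * nsq f := by
  unfold nsq
  rw [mul_sum, ← Equiv.sum_comp (Equiv.addRight (unitVec N μ + unitVec N ν)) (fun y => af ^ 2 * ‖f y‖ ^ 2)]
  refine sum_le_sum fun y _ => ?_
  have ey : (Equiv.addRight (unitVec N μ + unitVec N ν)) y = y + unitVec N μ + unitVec N ν := by
    rw [Equiv.coe_addRight, add_assoc]
  rw [ey, comm_Tm_mulVec, norm_mul, mul_pow]
  exact mul_le_mul_of_nonneg_right (pow_le_pow_left₀ (norm_nonneg _) (haf y μ ν) 2) (sq_nonneg _)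

/-- `Σ|[T_νᴴ,T_μ]λ|² ≤ a_f²·Σ|λ|²` (unit-modulus phases). [folklore] -/
theorem nsq_mixed_le (hR : ∀ y μ, ‖R y μ‖ = 1) {af : ℝ} (haf : ∀ y μ ν, ‖plaq N R y μ ν‖ ≤ af) (μ ν : Fin d) (f : Tor N → ℂ) :
    nsq (((Tm N R ν)ᴴ * Tm N R μ - Tm N R μ * (Tm N R ν)ᴴ) *ᵥ f) ≤ af ^ 2 * nsq f := by
  unfold nsq
  rw [mul_sum, ← Equiv.sum_comp (Equiv.addRight (unitVec N μ - unitVec N ν)) (fun y => af ^ 2 * ‖f y‖ ^ 2)]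
  refine sum_le_sum fun y _ => ?_
  have ey : (Equiv.addRight (unitVec N μ - unitVec N ν)) y = y - unitVec N ν + unitVec N μ := by
    rw [Equiv.coe_addRight]; abel
  rw [ey, comm_TmH_Tm_mulVec, norm_mul, mul_pow, norm_mixed_coeff N R hR]
  exact mul_le_mul_of_nonneg_right (pow_le_pow_left₀ (norm_nonneg _) (haf _ μ ν) 2) (sq_nonneg _)

/-! ## §3 The covariant lattice H²-estimate -/

/-- the covariant Laplacian `Δ_R = Σ_μ D_μᴴ D_μ` ([B9] (3.23) shape). [folklore] -/
def Lap : Matrix (Tor N) (Tor N) ℂ := ∑ μ, (Dm N R μ)ᴴ * Dm N R μ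

/-- the plaquette commutator `C_{νμ} = [T_ν, T_μ]` and the mixed commutator `C′_{νμ} = [T_νᴴ, T_μ]`. [folklore] -/
def Cpl (ν μ : Fin d) : Matrix (Tor N) (Tor N) ℂ := Tm N R ν * Tm N R μ - Tm N R μ * Tm N R ν

/-- the mixed commutator `C′_{νμ} = T_νᴴ T_μ − T_μ T_νᴴ`. [folklore] -/
def Cmx (ν μ : Fin d) : Matrix (Tor N) (Tor N) ℂ := (Tm N R ν)ᴴ * Tm N R μ - Tm N R μ * (Tm N R ν)ᴴ

/-- **the Bochner identity for one pair of directions**: `D_μᴴ D_νᴴ D_ν D_μ = D_μᴴ D_μ D_νᴴ D_ν + D_μᴴ D_νᴴ C_{νμ} + D_μᴴ C′_{νμ} D_ν`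
(the commutators of the covariant differences are those of the covariant shifts). [folklore] -/
theorem bochner_pair (ν μ : Fin d) :
    (Dm N R μ)ᴴ * (Dm N R ν)ᴴ * Dm N R ν * Dm N R μ
      = (Dm N R μ)ᴴ * Dm N R μ * ((Dm N R ν)ᴴ * Dm N R ν) + (Dm N R μ)ᴴ * (Dm N R ν)ᴴ * Cpl N R ν μ
        + (Dm N R μ)ᴴ * Cmx N R ν μ * Dm N R ν := by
  -- the free-ring identity `P(Yh−1)(Y−1)(X−1) = P(X−1)(Yh−1)(Y−1) + P(Yh−1)(YX−XY) + P(YhX−XYh)(Y−1)`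
  have key : ∀ P X Y Yh : Matrix (Tor N) (Tor N) ℂ,
      P * (Yh - 1) * (Y - 1) * (X - 1) = P * (X - 1) * ((Yh - 1) * (Y - 1)) + P * (Yh - 1) * (Y * X - X * Y) + P * (Yh * X - X * Yh) * (Y - 1) := by
    intro P X Y Yh; noncomm_ring
  have hD : (Dm N R ν)ᴴ = (Tm N R ν)ᴴ - 1 := by rw [Dm, Matrix.conjTranspose_sub, Matrix.conjTranspose_one]
  rw [hD, Cpl, Cmx]
  exact key _ _ _ _

/-- the summed identity: `Σ_{ν,μ} (D_νD_μ)ᴴ(D_νD_μ) = Δ_R·Δ_R + E`, `E = Σ_{ν,μ} (D_μᴴD_νᴴC_{νμ} + D_μᴴC′_{νμ}D_ν)`. [folklore] -/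
theorem bochner_sum :
    ∑ ν, ∑ μ, (Dm N R ν * Dm N R μ)ᴴ * (Dm N R ν * Dm N R μ)
      = Lap N R * Lap N R + ∑ ν, ∑ μ, ((Dm N R μ)ᴴ * (Dm N R ν)ᴴ * Cpl N R ν μ + (Dm N R μ)ᴴ * Cmx N R ν μ * Dm N R ν) := by
  have h1 : ∀ ν μ, (Dm N R ν * Dm N R μ)ᴴ * (Dm N R ν * Dm N R μ)
      = (Dm N R μ)ᴴ * Dm N R μ * ((Dm N R ν)ᴴ * Dm N R ν)
        + ((Dm N R μ)ᴴ * (Dm N R ν)ᴴ * Cpl N R ν μ + (Dm N R μ)ᴴ * Cmx N R ν μ * Dm N R ν) := by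
    intro ν μ
    have hb := bochner_pair N R ν μ
    rw [Matrix.conjTranspose_mul]
    simp only [Matrix.mul_assoc] at hb ⊢
    rw [hb, add_assoc]
  simp_rw [h1, Finset.sum_add_distrib]
  congr 1
  rw [Lap, Finset.sum_mul_sum, Finset.sum_comm]

/-- `re λ†(PᴴP)λ = Σ|Pλ|²`. [folklore] -/
theorem re_form_gram (P : Matrix (Tor N) (Tor N) ℂ) (f : Tor N → ℂ) : (star f ⬝ᵥ ((Pᴴ * P) *ᵥ f)).re = nsq (P *ᵥ f) := by
  rw [← Matrix.mulVec_mulVec, star_dotProduct_conjTranspose_mulVec,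
    star_dotProduct_self, Complex.ofReal_re]

/-- the Laplacian is Hermitian. [folklore] -/
theorem Lap_conjTranspose : (Lap N R)ᴴ = Lap N R := by
  unfold Lap
  rw [Matrix.conjTranspose_sum]
  exact Finset.sum_congr rfl fun μ _ => by rw [Matrix.conjTranspose_mul, Matrix.conjTranspose_conjTranspose]

/-- `re λ†(Δ_R·Δ_R)λ = Σ|Δ_R λ|²`. [folklore] -/
theorem re_form_Lap_sq (f : Tor N → ℂ) : (star f ⬝ᵥ ((Lap N R * Lap N R) *ᵥ f)).re = nsq (Lap N R *ᵥ f) := by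
  have h := re_form_gram N (Lap N R) f
  rwa [Lap_conjTranspose] at h

/-- a Cauchy–Schwarz step: `re x†(A y) ≤ √(Σ|x|²)·√(Σ|Ay|²)`. [folklore] -/
theorem re_dot_le (x z : Tor N → ℂ) : (star x ⬝ᵥ z).re ≤ Real.sqrt (nsq x) * Real.sqrt (nsq z) :=
  (Complex.re_le_norm _).trans (norm_star_dotProduct_le x z)

/-- `Σ_{i∈s} √(a i) ≤ √(|s|·Σ a i)` for nonnegative `a`. [folklore] -/
theorem sum_sqrt_le {ι : Type*} (s : Finset ι) (a : ι → ℝ) (ha : ∀ i ∈ s, 0 ≤ a i) :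
    ∑ i ∈ s, Real.sqrt (a i) ≤ Real.sqrt (s.card * ∑ i ∈ s, a i) := by
  have h := sq_sum_le_card_mul_sum_sq (s := s) (f := fun i => Real.sqrt (a i))
  have e : ∑ i ∈ s, Real.sqrt (a i) ^ 2 = ∑ i ∈ s, a i := Finset.sum_congr rfl fun i hi => Real.sq_sqrt (ha i hi)
  rw [e] at h
  exact Real.le_sqrt_of_sq_le h

/-- the covariant H² functional `ρ(λ) = Σ_{ν,μ} Σ_y |D_ν D_μ λ(y)|²`. [folklore] -/
def rho (f : Tor N → ℂ) : ℝ := ∑ ν, ∑ μ, nsq ((Dm N R ν * Dm N R μ) *ᵥ f)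

/-- the covariant Dirichlet functional `F(λ) = Σ_μ Σ_y |D_μ λ(y)|²` (`= Σ_μ dirU`). [folklore] -/
def dirF (f : Tor N → ℂ) : ℝ := ∑ μ, nsq (Dm N R μ *ᵥ f)

/-- the form of the summed Bochner identity: `ρ(λ) = Σ|Δ_Rλ|² + Σ_{ν,μ} (re λ†D_μᴴD_νᴴC_{νμ}λ + re λ†D_μᴴC′_{νμ}D_νλ)`. [folklore] -/
theorem form_bochner (f : Tor N → ℂ) :
    rho N R f = nsq (Lap N R *ᵥ f)
      + ∑ ν, ∑ μ, ((star f ⬝ᵥ (((Dm N R μ)ᴴ * (Dm N R ν)ᴴ * Cpl N R ν μ) *ᵥ f)).re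
          + (star f ⬝ᵥ (((Dm N R μ)ᴴ * Cmx N R ν μ * Dm N R ν) *ᵥ f)).re) := by
  have h := congrArg (fun A : Matrix (Tor N) (Tor N) ℂ => (star f ⬝ᵥ (A *ᵥ f)).re) (bochner_sum N R)
  simp only [Matrix.sum_mulVec, Matrix.add_mulVec, dotProduct_add, dotProduct_sum, Complex.add_re, Complex.re_sum] at h
  rw [re_form_Lap_sq] at h
  have e : ∀ ν μ, (star f ⬝ᵥ (((Dm N R ν * Dm N R μ)ᴴ * (Dm N R ν * Dm N R μ)) *ᵥ f)).re = nsq ((Dm N R ν * Dm N R μ) *ᵥ f) :=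
    fun ν μ => re_form_gram N _ f
  simp only [e] at h
  rw [rho, h]

/-- **THE COVARIANT LATTICE H²-ESTIMATE** (leaf REG⁺'s core): for unit-modulus phases with plaquette defects `≤ a_f` and every field `λ`,
`ρ(λ) ≤ 2·Σ|Δ_R λ|² + (d·a_f)²·Σ|λ|² + 2d·a_f·F(λ)`. [folklore] -/
theorem h2_estimate (hR : ∀ y μ, ‖R y μ‖ = 1) {af : ℝ} (haf0 : 0 ≤ af) (haf : ∀ y μ ν, ‖plaq N R y μ ν‖ ≤ af) (f : Tor N → ℂ) :
    rho N R f ≤ 2 * nsq (Lap N R *ᵥ f) + (d * af) ^ 2 * nsq f + 2 * d * af * dirF N R f := by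
  have hρ0 : 0 ≤ rho N R f := sum_nonneg fun ν _ => sum_nonneg fun μ _ => nsq_nonneg _
  have hF0 : 0 ≤ dirF N R f := sum_nonneg fun μ _ => nsq_nonneg _
  have hf0 : 0 ≤ nsq f := nsq_nonneg f
  have hd : (0 : ℝ) ≤ d := Nat.cast_nonneg d
  -- bounds on the two error terms
  have t1 : ∀ ν μ, (star f ⬝ᵥ (((Dm N R μ)ᴴ * (Dm N R ν)ᴴ * Cpl N R ν μ) *ᵥ f)).re
      ≤ Real.sqrt (nsq ((Dm N R ν * Dm N R μ) *ᵥ f)) * (af * Real.sqrt (nsq f)) := by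
    intro ν μ
    have e : star f ⬝ᵥ (((Dm N R μ)ᴴ * (Dm N R ν)ᴴ * Cpl N R ν μ) *ᵥ f)
        = star ((Dm N R ν * Dm N R μ) *ᵥ f) ⬝ᵥ (Cpl N R ν μ *ᵥ f) := by
      rw [← Matrix.mulVec_mulVec, ← Matrix.mulVec_mulVec, star_dotProduct_conjTranspose_mulVec, star_dotProduct_conjTranspose_mulVec,
        Matrix.mulVec_mulVec]
    rw [e]
    refine (re_dot_le N _ _).trans (mul_le_mul_of_nonneg_left ?_ (Real.sqrt_nonneg _))
    calc Real.sqrt (nsq (Cpl N R ν μ *ᵥ f)) ≤ Real.sqrt (af ^ 2 * nsq f) := Real.sqrt_le_sqrt (nsq_comm_le N R haf ν μ f)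
      _ = af * Real.sqrt (nsq f) := by rw [Real.sqrt_mul (sq_nonneg _), Real.sqrt_sq haf0]
  have t2 : ∀ ν μ, (star f ⬝ᵥ (((Dm N R μ)ᴴ * Cmx N R ν μ * Dm N R ν) *ᵥ f)).re
      ≤ Real.sqrt (nsq (Dm N R μ *ᵥ f)) * (af * Real.sqrt (nsq (Dm N R ν *ᵥ f))) := by
    intro ν μ
    have e : star f ⬝ᵥ (((Dm N R μ)ᴴ * Cmx N R ν μ * Dm N R ν) *ᵥ f) = star (Dm N R μ *ᵥ f) ⬝ᵥ (Cmx N R ν μ *ᵥ (Dm N R ν *ᵥ f)) := by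
      rw [← Matrix.mulVec_mulVec, ← Matrix.mulVec_mulVec, star_dotProduct_conjTranspose_mulVec]
    rw [e]
    refine (re_dot_le N _ _).trans (mul_le_mul_of_nonneg_left ?_ (Real.sqrt_nonneg _))
    calc Real.sqrt (nsq (Cmx N R ν μ *ᵥ (Dm N R ν *ᵥ f))) ≤ Real.sqrt (af ^ 2 * nsq (Dm N R ν *ᵥ f)) :=
          Real.sqrt_le_sqrt (nsq_mixed_le N R hR haf μ ν _)
      _ = af * Real.sqrt (nsq (Dm N R ν *ᵥ f)) := by rw [Real.sqrt_mul (sq_nonneg _), Real.sqrt_sq haf0]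
  -- Cauchy–Schwarz over the index pairs
  have cs1 : ∑ ν, ∑ μ, Real.sqrt (nsq ((Dm N R ν * Dm N R μ) *ᵥ f)) ≤ d * Real.sqrt (rho N R f) := by
    have h := sum_sqrt_le (Finset.univ : Finset (Fin d × Fin d)) (fun p => nsq ((Dm N R p.1 * Dm N R p.2) *ᵥ f)) (fun _ _ => nsq_nonneg _)
    rw [Finset.card_univ, Fintype.card_prod, Fintype.card_fin] at h
    have e0 : (∑ i : Fin d × Fin d, nsq ((Dm N R i.1 * Dm N R i.2) *ᵥ f)) = rho N R f := by rw [rho, Fintype.sum_prod_type]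
    have e1 : (∑ i : Fin d × Fin d, Real.sqrt (nsq ((Dm N R i.1 * Dm N R i.2) *ᵥ f)))
        = ∑ ν, ∑ μ, Real.sqrt (nsq ((Dm N R ν * Dm N R μ) *ᵥ f)) := by rw [Fintype.sum_prod_type]
    rw [e0, e1] at h
    refine h.trans (le_of_eq ?_)
    have e : ((d * d : ℕ) : ℝ) * rho N R f = ((d : ℝ) * Real.sqrt (rho N R f)) ^ 2 := by
      rw [mul_pow, Real.sq_sqrt hρ0]; push_cast; ring
    rw [e, Real.sqrt_sq (by positivity)]
  have cs2 : ∑ ν, ∑ μ, Real.sqrt (nsq (Dm N R μ *ᵥ f)) * Real.sqrt (nsq (Dm N R ν *ᵥ f)) ≤ d * dirF N R f := by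
    have h := sq_sum_le_card_mul_sum_sq (s := (Finset.univ : Finset (Fin d))) (f := fun μ => Real.sqrt (nsq (Dm N R μ *ᵥ f)))
    rw [Finset.card_univ, Fintype.card_fin] at h
    have e2 : ∑ μ, Real.sqrt (nsq (Dm N R μ *ᵥ f)) ^ 2 = dirF N R f := by
      rw [dirF]; exact Finset.sum_congr rfl fun μ _ => Real.sq_sqrt (nsq_nonneg _)
    rw [e2] at h
    have e : ∑ ν, ∑ μ, Real.sqrt (nsq (Dm N R μ *ᵥ f)) * Real.sqrt (nsq (Dm N R ν *ᵥ f))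
        = (∑ μ, Real.sqrt (nsq (Dm N R μ *ᵥ f))) ^ 2 := by
      rw [sq, Finset.sum_mul_sum]
      exact Finset.sum_congr rfl fun ν _ => Finset.sum_congr rfl fun μ _ => mul_comm _ _
    rw [e]; exact h
  -- assemble
  have main : rho N R f ≤ nsq (Lap N R *ᵥ f) + d * Real.sqrt (rho N R f) * (af * Real.sqrt (nsq f)) + af * (d * dirF N R f) := by
    have s1 := Finset.sum_le_sum fun ν (_ : ν ∈ Finset.univ) => Finset.sum_le_sum fun μ (_ : μ ∈ Finset.univ) => add_le_add (t1 ν μ) (t2 ν μ)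
    simp only [Finset.sum_add_distrib] at s1
    have e1 : ∑ ν, ∑ μ, Real.sqrt (nsq ((Dm N R ν * Dm N R μ) *ᵥ f)) * (af * Real.sqrt (nsq f))
        = (∑ ν, ∑ μ, Real.sqrt (nsq ((Dm N R ν * Dm N R μ) *ᵥ f))) * (af * Real.sqrt (nsq f)) := by
      rw [Finset.sum_mul]; exact Finset.sum_congr rfl fun ν _ => by rw [Finset.sum_mul]
    have e2 : ∑ ν, ∑ μ, Real.sqrt (nsq (Dm N R μ *ᵥ f)) * (af * Real.sqrt (nsq (Dm N R ν *ᵥ f)))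
        = af * ∑ ν, ∑ μ, Real.sqrt (nsq (Dm N R μ *ᵥ f)) * Real.sqrt (nsq (Dm N R ν *ᵥ f)) := by
      rw [Finset.mul_sum]; refine Finset.sum_congr rfl fun ν _ => ?_
      rw [Finset.mul_sum]; exact Finset.sum_congr rfl fun μ _ => by ring
    rw [e1, e2] at s1
    have hb : 0 ≤ af * Real.sqrt (nsq f) := by positivity
    have p1 := mul_le_mul_of_nonneg_right cs1 hb
    have p2 := mul_le_mul_of_nonneg_left cs2 haf0
    have hfb := form_bochner N R f
    simp only [Finset.sum_add_distrib] at hfb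
    linarith [s1, p1, p2, hfb]
  -- absorb √ρ
  have hab : d * Real.sqrt (rho N R f) * (af * Real.sqrt (nsq f)) ≤ rho N R f / 2 + (d * af) ^ 2 * nsq f / 2 := by
    have h0 : 0 ≤ (Real.sqrt (rho N R f) - d * af * Real.sqrt (nsq f)) ^ 2 := sq_nonneg _
    nlinarith [Real.sq_sqrt hρ0, Real.sq_sqrt hf0, h0]
  linarith [main, hab]

end Summit.QuantumFields.BalabanUV.T4Continuum.VariationalCovariantH2

end
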